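import Summits.QuantumFields.YangMills.Theorems.BalabanUVNodesN15KingModelGraphReplacementKing
import Summits.QuantumFields.YangMills.Theorems.BalabanUVNodesN15KingModelContourPhaseRate

/-!
# BalabanUVNodes ∕ N15 — THE KING-MODEL RUNG (PART Η-d): THE DRESSED-VERTEX EDITION OF PROPOSITION 3.6's REPLACEMENT STEP — graphs whose internal lines
# carry King's `A = 0` slices and whose vertices carry the DRESSINGS (3.46) `U(B(Γ^{(k)}_{x₀,v}))` of a CONSTANT regular background `B = A_k(x₀)`, replaced
# via **(3.72) BY NAME** (part Κ-b `ineq372Printed_king`): WHAT THE CURVED CASE ADDS AT GRAPH LEVEL in the model = `|Υ_dressed| × (3.72)` per unit size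
# (Track A, DAG node N15 = NE2; FAN-OUT v1.1 §N15 s3 «KING-MODEL RUNG … + the one-line statement of what the curved case adds»)

HONEST FRAMING.  Count-neutral (cell `pub-ymgap`, seat `pub-ymgap-dag-n15-e` g25; `--supports stmt-QuantumFields-27366 --as helper` = K3⁸
`SpineGivenEndpointR13SepCoPHV`).  TEMPLATE LITERATURE: C. King, *The U(1) Higgs model. I. The continuum limit*, Commun. Math. Phys. **102** (1986) 649–677
[King1986], proof of Proposition 3.6, p. 665: *«The operator (3.46) can be replaced using the following bound: |U(B(Γ^{(k+n)}_{x₀,x′})) − U(B(Γ^{(k)}_{x₀,x}))| ≤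
Ce(L^kε)^{2−d/2}L^{−k} p(L^kε)/(μ₀L^kε). (3.72)»* — the dressings (3.46) p. 661 *«U(B(Γ^{(k)}_{x₀,v})) = exp[e(L^kε)^{2−d/2}qB(Γ^{(k)}_{x₀,v})]»* at the vertices
`{v_i}` are ONE-VERTEX FACTORS of the graph value, of size `1` (`q = i`) and two-spacing rate (3.72); part Η-a's engine replaces them one by one together with
the internal lines.  King's U(1)∕`A = 0`-slices MODEL with a CONSTANT background `B` (p. 661 «Let B be the value of A_k at some point x₀ in □′»); NOT Bałaban's
non-abelian `G(U)` of [B9] (road (c) = dag-n15-c); NOT a node discharge; nothing continuum ∕ ℝ⁴ ∕ OS ∕ mass-gap ∕ Clay.  0 `sorry`; standard axioms.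

WHAT THIS FILE PROVES.
* §1 (namespace `…N15KingModelRung.Graph`, on the typer's `TwoSpacing` record, COMPLEX-valued graph values): ★★ `graph_replacement_twoSpacing_ratio_complex`
  — part Η-b's ratio form with the real slices `G_(j)`∕`∂_μG_(j)` read in `ℂ` on the lines and arbitrary complex one-vertex factors with sizes `p_υ` and
  proportional rates `ϑ_υ p_υ`: `‖E_hi − E_lo‖ ≤ (Σ_ℓ L^{−γ j_ℓ} + Σ_υ ϑ_υ)·𝔼(H(j))` (engine `norm_graphValLS_sub_le_of_ratio` at `𝕜 = ℂ`).
* §2 (namespace `…N15KingModelRung.Curved`, BY NAME at `A = 0`): `kingDressTheta` = the right side of (3.72) with Κ-b's constant `C = (d+1)·L·(1+log L)^p`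
  (`Θ_K = C·e·(L^kε)^{2−(d+1)/2}·L^{−K}·p(L^kε)/(μ₀L^kε)`); ★★★ **`king_graph_replacement_dressed`**: for odd `L ≥ 3`, `a > 0`, `m₀² ≥ 0`, `0 < α < 1` there are
  `C, δ₀, γ > 0` (those of part Η-c) such that for every mass `0 < m² ≤ m₀²`, volume∕scales `j` (`K = j.K`), `n ≥ 1`, every graph shape with slice indices
  `j_ℓ + 1 ≤ K`, every set `Υ` of DRESSED VERTICES (heads `h_υ` on the unit lattice — the phase of `Γ_{x₀, y}` — charge `e ≥ 0`, `μ₀ > 0`, `0 < L^kε ≤ 1`,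
  `b₀, p ≥ 0`, a constant background `|B_μ| ≤ p(L^{k−1}ε)/(μ₀L^{k−1}ε)`):
  `‖E^{(K+n)}_ℂ(H(j); U′-dressed) − E^{(K)}_ℂ(H(j); U-dressed)‖ ≤ (Σ_ℓ L^{−γ j_ℓ} + |Υ|·Θ_K)·𝔼^{(K)}_{C,δ₀}(H(j))` — the curved case (constant background) adds
  `|Υ|·Θ_K = |Υ| × (3.72)` per unit (3.63)-size, FIRST ORDER in `η = L^{−K}` (tight: part Κ-c `kingDressing_gap_lower`); ★ `king_graph_replacement_dressed_flat`:
  at `B = 0` the dressings cancel exactly (Κ-b `kingDressing_sub_eq_zero_of_field_zero`) and the bound is part Η-c's `Σ_ℓ L^{−γ j_ℓ}` alone.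

HONEST SCOPE.  (a) Model level: King's `A = 0` slices on the lines (Props. 3.7∕3.9 by name via part Η-c), U(1) dressings of a CONSTANT field on the vertices
((3.46) with `q = i`, head phases arbitrary); the LIVE-background propagators `G_k(□′, Ã^{(k)})`, the `Ã`-vertices of (3.47)–(3.53) and the δ-propagators are
NOT on these graphs (their by-name model statements are parts Θ⁺∕Ζ; the vertex expansion is lit-balaban's B1 (3.13)–(3.16)).  (b) The replacement step only;
no power counting.  (c) NOT Bałaban's `G(U)`; NE2 not touched; N15's booking unchanged; counts unmoved.
Locators: [King1986] (3.46) p.661, Prop. 3.6 p.662, (3.63) p.663, p.664 (pairing), (3.72)–(3.73) p.665, pp.664–665 (replacement step).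
-/

noncomputable section

open scoped BigOperators
open Finset

/-! ## §1 The ratio form of the replacement step with complex one-vertex factors (real slices read in `ℂ`) -/

namespace Summit.QuantumFields.YangMills.BalabanUVNodes.N15KingModelRung.Graph

open Literature.MathematicalPhysics.QuantumFieldTheory.King1986.SlicePropagator (SliceKernels TwoSpacing Prop37PrintedAt Prop39PrintedAt)

section Complex

variable {d : ℕ} (T : TwoSpacing d) [Fintype T.lo.S] [DecidableEq T.lo.S] [Fintype T.hi.S]
variable {V Λ Υ : Type*} [Fintype V] [DecidableEq V] [Fintype Λ] [DecidableEq Λ] [Fintype Υ] [DecidableEq Υ]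

/-- ★★ **THE RATIO FORM WITH COMPLEX ONE-VERTEX FACTORS**: internal lines carry the REAL slices `G_(j)`∕`∂_μG_(j)` read in `ℂ` (sizes Prop. 3.7, rates Prop.
3.9 by name as in part Η-b), the one-vertex factors `u_υ`, `u′_υ` are complex (dressings (3.46), complex sources) with sizes `p_υ` and proportional rates
`ϑ_υ·p_υ`; vertex weights real (`m·w′ = w`).  `‖E_hi − E_lo‖ ≤ (Σ_ℓ L^{−γ j_ℓ} + Σ_υ ϑ_υ)·𝔼(H(j))`.
[cite: King1986, pp.664–665 (proof of Prop. 3.6), (3.46) p.661, (3.63) p.663, (3.72)–(3.73) p.665] -/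
theorem graph_replacement_twoSpacing_ratio_complex (hL : 0 < T.lo.L) {α C δ₀ γ : ℝ} (h37 : Prop37PrintedAt α T.lo C δ₀)
    (hhi : ∀ j : ℕ, j + 1 ≤ T.lo.k → ∀ (κ : Option (Fin d)) (x' y' : T.hi.S),
      ‖hiLine T j κ x' y'‖ ≤ sizeProfile T C δ₀ j κ (T.pt x') (T.pt y'))
    (h39 : Prop39PrintedAt α T C δ₀ γ)
    {m : ℕ} (hfib : ∀ x : T.lo.S, (univ.filter fun x' : T.hi.S => T.pt x' = x).card = m) {w w' : ℝ} (hw : (m : ℝ) * w' = w)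
    (src tgt : Λ → V) (js : Λ → ℕ) (hjs : ∀ ℓ, js ℓ + 1 ≤ T.lo.k) (κ : Λ → Option (Fin d)) (vtx : Υ → V)
    (u : Υ → T.lo.S → ℂ) (u' : Υ → T.hi.S → ℂ) (p : Υ → T.lo.S → ℝ) (ϑ : Υ → ℝ)
    (hp : ∀ υ x, ‖u υ x‖ ≤ p υ x) (hp' : ∀ υ x', ‖u' υ x'‖ ≤ p υ (T.pt x'))
    (hq : ∀ υ x', ‖u' υ x' - u υ (T.pt x')‖ ≤ ϑ υ * p υ (T.pt x')) :
    ‖graphValLS (w' : ℂ) src tgt (fun ℓ x' y' => (hiLine T (js ℓ) (κ ℓ) x' y' : ℂ)) vtx u'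
        - graphValLS (w : ℂ) src tgt (fun ℓ x y => (loLine T (js ℓ) (κ ℓ) x y : ℂ)) vtx u‖
      ≤ (∑ ℓ, (T.lo.L : ℝ) ^ (-(γ * js ℓ)) + ∑ υ, ϑ υ) * graphValLS ‖w‖ src tgt (fun ℓ => sizeProfile T C δ₀ (js ℓ) (κ ℓ)) vtx p := by
  have hw' : ((m : ℂ)) * (w' : ℂ) = (w : ℂ) := by exact_mod_cast hw
  have h := norm_graphValLS_sub_le_of_ratio (𝕜 := ℂ) T.pt hfib hw' src tgt vtx
    (fun ℓ x y => (loLine T (js ℓ) (κ ℓ) x y : ℂ)) (fun ℓ x' y' => (hiLine T (js ℓ) (κ ℓ) x' y' : ℂ))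
    (fun ℓ => sizeProfile T C δ₀ (js ℓ) (κ ℓ)) (fun ℓ => (T.lo.L : ℝ) ^ (-(γ * T.lo.k)) * T.lo.slice (js ℓ) ^ (-γ))
    (fun ℓ x y => by rw [Complex.norm_real]; exact loLine_le_sizeProfile T h37 (hjs ℓ) (κ ℓ) x y)
    (fun ℓ x' y' => by rw [Complex.norm_real]; exact hhi (js ℓ) (hjs ℓ) (κ ℓ) x' y')
    (fun ℓ x' y' => by
      rw [← Complex.ofReal_sub, Complex.norm_real, ← rateProfile_eq_ratio_mul T hL]
      exact hiLine_sub_loLine_le_rateProfile T h39 (hjs ℓ) (κ ℓ) x' y') u u' p ϑ hp hp' hq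
  rw [Complex.norm_real] at h
  refine h.trans (le_of_eq ?_)
  congr 2
  exact sum_congr rfl fun ℓ _ => lineRatio_eq T hL γ (js ℓ)

end Complex

end Summit.QuantumFields.YangMills.BalabanUVNodes.N15KingModelRung.Graph

/-! ## §2 King's `A = 0` slices on the lines, the dressings (3.46) of a constant background on the vertices, replaced via (3.72) BY NAME -/

namespace Summit.QuantumFields.YangMills.BalabanUVNodes.N15KingModelRung.Curved

open Literature.MathematicalPhysics.QuantumFieldTheory.Balaban1983to89.B5Prop11Plancherel (Tor fine)
open Literature.MathematicalPhysics.QuantumFieldTheory.Balaban1983to89.B2 (pFn)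
open Literature.MathematicalPhysics.QuantumFieldTheory.King1986.SlicePropagator (Prop37PrintedAt Prop39PrintedAt)
open Summit.QuantumFields.YangMills.BalabanUVNodes.N15KingModelRung (KingVolIndex kingVol kingVol_neZero)
open Summit.QuantumFields.YangMills.BalabanUVNodes.N15KingModelRung.Graph

variable {d : ℕ} (L : ℕ) [NeZero L]

/-- **THE RIGHT SIDE OF (3.72) IN THE MODEL** with part Κ-b's constant `C = (d+1)·L·(1+log L)^p`: `Θ_K = C·e·(L^kε)^{2−(d+1)/2}·L^{−K}·p(L^kε)/(μ₀L^kε)` — the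
two-spacing rate of ONE dressing (3.46), first order in `η = L^{−K}`. [cite: King1986, (3.72) p.665] -/
def kingDressTheta (K : ℕ) (e μ₀ Lkε b₀ p : ℝ) : ℝ :=
  (((d : ℝ) + 1) * L * (1 + Real.log L) ^ p) * e * Lkε ^ ((2 : ℝ) - ((d + 1 : ℕ) : ℝ) / 2) * ((L : ℝ) ^ K)⁻¹ * (pFn b₀ p Lkε / (μ₀ * Lkε))

/-- ★★★ **PROPOSITION 3.6's REPLACEMENT STEP WITH DRESSED VERTICES, BY NAME AT `A = 0` AND A CONSTANT BACKGROUND `B`.**  With the constants `C, δ₀, γ` of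
part Η-c (one triple per Hölder exponent, uniform in the mass `0 < m² ≤ m₀²`, the volume, `K ≥ 1`, `n ≥ 1` and the graph): for every graph shape whose internal
lines carry King's `A = 0` slices `j_ℓ` (`j_ℓ + 1 ≤ K`) read in `ℂ`, and whose vertices `υ ∈ Υ` at `vtx υ` carry the DRESSINGS (3.46)
`U(B(Γ^{(K)}_{x₀,v})) = exp[i·e·(L^kε)^{2−(d+1)/2}·(h_υ(y) + B(Γ^{(K)}_{y,v}))]` (part Κ-b `kingDressing`; `y` = the unit block of `v`, `h_υ` the head phase of
`Γ_{x₀,y}`) — on the fine lattice the SAME heads with the finer contours `Γ^{(K+n)}` — for every `e ≥ 0`, `μ₀ > 0`, `0 < L^kε ≤ 1`, `b₀, p ≥ 0` and every constant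
background with `|B_μ| ≤ p(L^{k−1}ε)/(μ₀L^{k−1}ε)` ((3.2)₁):
`‖E^{(K+n)}_ℂ(H(j); U′) − E^{(K)}_ℂ(H(j); U)‖ ≤ (Σ_ℓ L^{−γ j_ℓ} + |Υ|·Θ_K)·𝔼^{(K)}_{C,δ₀}(H(j))` — the vertex weights `η^{d+1}`, `η′^{d+1}`, the majorant graph with
unit vertex factors.  THE CURVED CASE (constant background) ADDS `|Υ| × (3.72)` PER UNIT (3.63)-SIZE, first order in `η`.  ASSEMBLY: part Η-c (lines) + Κ-b
`norm_kingDressing` (size `1`) + Κ-b `ineq372Printed_king` ((3.72) by name) on §1.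
[cite: King1986, p.665 («The operator (3.46) can be replaced using the following bound: (3.72)»), (3.46) p.661, (3.63) p.663, (3.72)–(3.73) p.665] -/
theorem king_graph_replacement_dressed (hLodd : Odd L) (hL : 2 ≤ L) {a : ℝ} (ha : 0 < a) {m0sq : ℝ} (hm0 : 0 ≤ m0sq)
    {α : ℝ} (hα0 : 0 < α) (hα1 : α < 1) :
    ∃ C δ₀ γ : ℝ, 0 < C ∧ 0 < δ₀ ∧ 0 < γ ∧ ∀ (msq : ℝ), 0 < msq → msq ≤ m0sq → ∀ (j : KingVolIndex d) (n : ℕ), 1 ≤ n →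
      ∀ (V Λ Υ : Type) [Fintype V] [DecidableEq V] [Fintype Λ] [DecidableEq Λ] [Fintype Υ] [DecidableEq Υ]
        (src tgt : Λ → V) (js : Λ → ℕ), (∀ ℓ, js ℓ + 1 ≤ j.K) → ∀ (κ : Λ → Option (Fin (d + 1))) (vtx : Υ → V)
        (h : Υ → Tor (kingVol L j) → ℝ) {e μ₀ Lkε b₀ p : ℝ}, 0 ≤ e → 0 < μ₀ → 0 < Lkε → Lkε ≤ 1 → 0 ≤ b₀ → 0 ≤ p →
        ∀ {B : Fin (d + 1) → ℝ}, (∀ μ, |B μ| ≤ pFn b₀ p (Lkε / L) * (μ₀ * (Lkε / L))⁻¹) →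
        haveI := kingVol_neZero L j
        ‖graphValLS ((((((L : ℝ) ^ (j.K + n))⁻¹) ^ (d + 1) : ℝ) : ℂ)) src tgt (fun ℓ x' y' => (kingHiLine L a msq j n (js ℓ) (κ ℓ) x' y' : ℂ)) vtx
              (fun υ x' => kingDressing L (j.K + n) (kingVol L j) e (Lkε ^ ((2 : ℝ) - ((d + 1 : ℕ) : ℝ) / 2)) (h υ) B x')
            - graphValLS ((((((L : ℝ) ^ j.K)⁻¹) ^ (d + 1) : ℝ) : ℂ)) src tgt (fun ℓ x y => (kingLoLine L a msq j n (js ℓ) (κ ℓ) x y : ℂ)) vtx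
              (fun υ x => kingDressing L j.K (kingVol L j) e (Lkε ^ ((2 : ℝ) - ((d + 1 : ℕ) : ℝ) / 2)) (h υ) B x)‖
          ≤ (∑ ℓ, (L : ℝ) ^ (-(γ * js ℓ)) + Fintype.card Υ * kingDressTheta (d := d) L j.K e μ₀ Lkε b₀ p)
              * graphValLS ((((L : ℝ) ^ j.K)⁻¹) ^ (d + 1)) src tgt (fun ℓ => kingSizeProfile L a msq j n C δ₀ (js ℓ) (κ ℓ)) vtx (fun _ _ => (1 : ℝ)) := by
  obtain ⟨C, δ₀, γ, hC, hδ₀, hγ, H⟩ := king_props37_38_39_commonConstants (d := d) L hLodd hL ha hm0 hα0 hα1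
  have hL1 : 1 ≤ L := by omega
  have hL0 : (0 : ℝ) < L := by exact_mod_cast (show 0 < L by omega)
  refine ⟨C * Real.exp δ₀, δ₀, γ, by positivity, hδ₀, hγ,
    fun msq hm hcap j n hn V Λ Υ _ _ _ _ _ _ src tgt js hjs κ vtx h e μ₀ Lkε b₀ p he hμ₀ hε hε1 hb hp B hB => ?_⟩
  haveI := kingVol_neZero L j
  obtain ⟨h37, h37', -, h39⟩ := H msq hm hcap j n hn
  letI : Fintype (kingTwoSpacingFull L a msq j n).lo.S := inferInstanceAs (Fintype (Tor (fine (L ^ j.K) (kingVol L j))))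
  letI : DecidableEq (kingTwoSpacingFull L a msq j n).lo.S := inferInstanceAs (DecidableEq (Tor (fine (L ^ j.K) (kingVol L j))))
  letI : Fintype (kingTwoSpacingFull L a msq j n).hi.S := inferInstanceAs (Fintype (Tor (fine (L ^ (j.K + n)) (kingVol L j))))
  have hCe : C ≤ C * Real.exp δ₀ := le_mul_of_one_le_right hC.le (Real.one_le_exp hδ₀.le)
  have h37e : Prop37PrintedAt α (kingTwoSpacingFull L a msq j n).lo (C * Real.exp δ₀) δ₀ :=
    prop37PrintedAt_mono (D := (kingTwoSpacingFull L a msq j n).lo) hL1 (kingTwoSpacingFull_lodist_nonneg L a msq j n)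
      (fun _ _ b => nomatch b) hC.le hCe le_rfl h37
  have h39e : Prop39PrintedAt α (kingTwoSpacingFull L a msq j n) (C * Real.exp δ₀) δ₀ γ :=
    prop39PrintedAt_mono (T := kingTwoSpacingFull L a msq j n) hL1 (kingTwoSpacingFull_lodist_nonneg L a msq j n)
      (fun _ _ b => nomatch b) hC.le hCe le_rfl le_rfl h39
  have hhi : ∀ jl : ℕ, jl + 1 ≤ (kingTwoSpacingFull L a msq j n).lo.k →
      ∀ (κ : Option (Fin (d + 1))) (x' y' : (kingTwoSpacingFull L a msq j n).hi.S),
      ‖hiLine (kingTwoSpacingFull L a msq j n) jl κ x' y'‖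
        ≤ sizeProfile (kingTwoSpacingFull L a msq j n) (C * Real.exp δ₀) δ₀ jl κ
          ((kingTwoSpacingFull L a msq j n).pt x') ((kingTwoSpacingFull L a msq j n).pt y') :=
    fun jl hjl κ x' y' => hiLine_kingTwoSpacingFull_le L hL a msq j n hC.le hδ₀.le h37' hjl κ x' y'
  have hfib : ∀ x : (kingTwoSpacingFull L a msq j n).lo.S,
      (univ.filter fun x' : (kingTwoSpacingFull L a msq j n).hi.S => (kingTwoSpacingFull L a msq j n).pt x' = x).card = (L ^ n) ^ (d + 1) :=
    fun x => card_filter_kingSlicePt L j.K n (kingVol L j) x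
  have hw := king_weight_repair (d := d) L hL0 j.K n
  have hTL : 0 < (kingTwoSpacingFull L a msq j n).lo.L := by show 0 < L; omega
  have h372 : ∀ υ : Υ, ∀ x' : Tor (fine (L ^ (j.K + n)) (kingVol L j)),
      ‖kingDressing L (j.K + n) (kingVol L j) e (Lkε ^ ((2 : ℝ) - ((d + 1 : ℕ) : ℝ) / 2)) (h υ) B x'
          - kingDressing L j.K (kingVol L j) e (Lkε ^ ((2 : ℝ) - ((d + 1 : ℕ) : ℝ) / 2)) (h υ) B (kingSlicePt L j.K n (kingVol L j) x')‖
        ≤ kingDressTheta (d := d) L j.K e μ₀ Lkε b₀ p * 1 := fun υ x' => by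
    rw [mul_one]
    exact ineq372Printed_king L j.K n (kingVol L j) (h υ) he hμ₀ hε hε1 hb hp hL1 hB x'
  have hmain := graph_replacement_twoSpacing_ratio_complex (kingTwoSpacingFull L a msq j n) hTL h37e hhi h39e hfib hw src tgt js hjs κ vtx
    (fun υ x => kingDressing L j.K (kingVol L j) e (Lkε ^ ((2 : ℝ) - ((d + 1 : ℕ) : ℝ) / 2)) (h υ) B x)
    (fun υ x' => kingDressing L (j.K + n) (kingVol L j) e (Lkε ^ ((2 : ℝ) - ((d + 1 : ℕ) : ℝ) / 2)) (h υ) B x')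
    (fun _ _ => (1 : ℝ)) (fun _ => kingDressTheta (d := d) L j.K e μ₀ Lkε b₀ p)
    (fun υ x => (norm_kingDressing L j.K (kingVol L j) e _ (h υ) B x).le)
    (fun υ x' => (norm_kingDressing L (j.K + n) (kingVol L j) e _ (h υ) B x').le) h372
  have hnorm : ‖(((L : ℝ) ^ j.K)⁻¹) ^ (d + 1)‖ = (((L : ℝ) ^ j.K)⁻¹) ^ (d + 1) := Real.norm_of_nonneg (by positivity)
  rw [hnorm, sum_const, card_univ, nsmul_eq_mul] at hmain
  exact hmain

/-- ★ **THE `A = 0` MEMBER: AT `B = 0` THE DRESSINGS CANCEL EXACTLY** (the head phase is read at the unit block, which the pairing preserves — Κ-b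
`kingDressing_sub_eq_zero_of_field_zero`), and the bound is part Η-c's line term alone: `‖E^{(K+n)}_ℂ − E^{(K)}_ℂ‖ ≤ (Σ_ℓ L^{−γ j_ℓ})·𝔼^{(K)}_{C,δ₀}(H(j))`.
[cite: King1986, (3.46) p.661, p.665 (proof of Prop. 3.6)] -/
theorem king_graph_replacement_dressed_flat (hLodd : Odd L) (hL : 2 ≤ L) {a : ℝ} (ha : 0 < a) {m0sq : ℝ} (hm0 : 0 ≤ m0sq)
    {α : ℝ} (hα0 : 0 < α) (hα1 : α < 1) :
    ∃ C δ₀ γ : ℝ, 0 < C ∧ 0 < δ₀ ∧ 0 < γ ∧ ∀ (msq : ℝ), 0 < msq → msq ≤ m0sq → ∀ (j : KingVolIndex d) (n : ℕ), 1 ≤ n →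
      ∀ (V Λ Υ : Type) [Fintype V] [DecidableEq V] [Fintype Λ] [DecidableEq Λ] [Fintype Υ] [DecidableEq Υ]
        (src tgt : Λ → V) (js : Λ → ℕ), (∀ ℓ, js ℓ + 1 ≤ j.K) → ∀ (κ : Λ → Option (Fin (d + 1))) (vtx : Υ → V)
        (h : Υ → Tor (kingVol L j) → ℝ) (e s : ℝ),
        haveI := kingVol_neZero L j
        ‖graphValLS ((((((L : ℝ) ^ (j.K + n))⁻¹) ^ (d + 1) : ℝ) : ℂ)) src tgt (fun ℓ x' y' => (kingHiLine L a msq j n (js ℓ) (κ ℓ) x' y' : ℂ)) vtx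
              (fun υ x' => kingDressing L (j.K + n) (kingVol L j) e s (h υ) (fun _ => 0) x')
            - graphValLS ((((((L : ℝ) ^ j.K)⁻¹) ^ (d + 1) : ℝ) : ℂ)) src tgt (fun ℓ x y => (kingLoLine L a msq j n (js ℓ) (κ ℓ) x y : ℂ)) vtx
              (fun υ x => kingDressing L j.K (kingVol L j) e s (h υ) (fun _ => 0) x)‖
          ≤ (∑ ℓ, (L : ℝ) ^ (-(γ * js ℓ)))
              * graphValLS ((((L : ℝ) ^ j.K)⁻¹) ^ (d + 1)) src tgt (fun ℓ => kingSizeProfile L a msq j n C δ₀ (js ℓ) (κ ℓ)) vtx (fun _ _ => (1 : ℝ)) := by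
  obtain ⟨C, δ₀, γ, hC, hδ₀, hγ, H⟩ := king_props37_38_39_commonConstants (d := d) L hLodd hL ha hm0 hα0 hα1
  have hL1 : 1 ≤ L := by omega
  have hL0 : (0 : ℝ) < L := by exact_mod_cast (show 0 < L by omega)
  refine ⟨C * Real.exp δ₀, δ₀, γ, by positivity, hδ₀, hγ,
    fun msq hm hcap j n hn V Λ Υ _ _ _ _ _ _ src tgt js hjs κ vtx h e s => ?_⟩
  haveI := kingVol_neZero L j
  obtain ⟨h37, h37', -, h39⟩ := H msq hm hcap j n hn
  letI : Fintype (kingTwoSpacingFull L a msq j n).lo.S := inferInstanceAs (Fintype (Tor (fine (L ^ j.K) (kingVol L j))))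
  letI : DecidableEq (kingTwoSpacingFull L a msq j n).lo.S := inferInstanceAs (DecidableEq (Tor (fine (L ^ j.K) (kingVol L j))))
  letI : Fintype (kingTwoSpacingFull L a msq j n).hi.S := inferInstanceAs (Fintype (Tor (fine (L ^ (j.K + n)) (kingVol L j))))
  have hCe : C ≤ C * Real.exp δ₀ := le_mul_of_one_le_right hC.le (Real.one_le_exp hδ₀.le)
  have h37e : Prop37PrintedAt α (kingTwoSpacingFull L a msq j n).lo (C * Real.exp δ₀) δ₀ :=
    prop37PrintedAt_mono (D := (kingTwoSpacingFull L a msq j n).lo) hL1 (kingTwoSpacingFull_lodist_nonneg L a msq j n)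
      (fun _ _ b => nomatch b) hC.le hCe le_rfl h37
  have h39e : Prop39PrintedAt α (kingTwoSpacingFull L a msq j n) (C * Real.exp δ₀) δ₀ γ :=
    prop39PrintedAt_mono (T := kingTwoSpacingFull L a msq j n) hL1 (kingTwoSpacingFull_lodist_nonneg L a msq j n)
      (fun _ _ b => nomatch b) hC.le hCe le_rfl le_rfl h39
  have hhi : ∀ jl : ℕ, jl + 1 ≤ (kingTwoSpacingFull L a msq j n).lo.k →
      ∀ (κ : Option (Fin (d + 1))) (x' y' : (kingTwoSpacingFull L a msq j n).hi.S),
      ‖hiLine (kingTwoSpacingFull L a msq j n) jl κ x' y'‖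
        ≤ sizeProfile (kingTwoSpacingFull L a msq j n) (C * Real.exp δ₀) δ₀ jl κ
          ((kingTwoSpacingFull L a msq j n).pt x') ((kingTwoSpacingFull L a msq j n).pt y') :=
    fun jl hjl κ x' y' => hiLine_kingTwoSpacingFull_le L hL a msq j n hC.le hδ₀.le h37' hjl κ x' y'
  have hfib : ∀ x : (kingTwoSpacingFull L a msq j n).lo.S,
      (univ.filter fun x' : (kingTwoSpacingFull L a msq j n).hi.S => (kingTwoSpacingFull L a msq j n).pt x' = x).card = (L ^ n) ^ (d + 1) :=
    fun x => card_filter_kingSlicePt L j.K n (kingVol L j) x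
  have hw := king_weight_repair (d := d) L hL0 j.K n
  have hTL : 0 < (kingTwoSpacingFull L a msq j n).lo.L := by show 0 < L; omega
  have h0 : ∀ υ : Υ, ∀ x' : Tor (fine (L ^ (j.K + n)) (kingVol L j)),
      ‖kingDressing L (j.K + n) (kingVol L j) e s (h υ) (fun _ => 0) x'
          - kingDressing L j.K (kingVol L j) e s (h υ) (fun _ => 0) (kingSlicePt L j.K n (kingVol L j) x')‖ ≤ 0 * 1 := fun υ x' => by
    rw [kingDressing_sub_eq_zero_of_field_zero, norm_zero, zero_mul]
  have hmain := graph_replacement_twoSpacing_ratio_complex (kingTwoSpacingFull L a msq j n) hTL h37e hhi h39e hfib hw src tgt js hjs κ vtx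
    (fun υ x => kingDressing L j.K (kingVol L j) e s (h υ) (fun _ => 0) x)
    (fun υ x' => kingDressing L (j.K + n) (kingVol L j) e s (h υ) (fun _ => 0) x')
    (fun _ _ => (1 : ℝ)) (fun _ => (0 : ℝ))
    (fun υ x => (norm_kingDressing L j.K (kingVol L j) e s (h υ) _ x).le)
    (fun υ x' => (norm_kingDressing L (j.K + n) (kingVol L j) e s (h υ) _ x').le) h0
  have hnorm : ‖(((L : ℝ) ^ j.K)⁻¹) ^ (d + 1)‖ = (((L : ℝ) ^ j.K)⁻¹) ^ (d + 1) := Real.norm_of_nonneg (by positivity)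
  rw [hnorm, sum_const_zero, add_zero] at hmain
  exact hmain

end Summit.QuantumFields.YangMills.BalabanUVNodes.N15KingModelRung.Curved

end
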